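/-
Copyright (c) 2026. All rights reserved.
Released under Apache 2.0 license as described in the file LICENSE.
Authors: abc-iut cell — φ2 twin (ruling α4-3 (iii), seat abc-iut-w4-d064) of abc-iut-w4-d080's TemperedReconstructionR3cProofs.lean; proofs ported verbatim with `hCV H ↦ hCV`.
-/
import Literature.AnabelianGeometry.SemiGraphs.TemperedReconstructionR3cProofs
import Literature.AnabelianGeometry.SemiGraphs.TemperedReconstructionR3Sub
import Literature.AnabelianGeometry.SemiGraphs.TemperedThm37OfCompactInVerticialAt
import HarnessLib

/-!
# [SemiAnbd] Cor 3.9 step (R3c) AT ONE GRAPH — φ2 twin of `TemperedReconstructionR3cProofs` (proof-only)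

Mochizuki, *Semi-graphs of anabelioids*, Publ. RIMS **42** (2006), §3, Corollary 3.9, proof p. 43
l. 13 "[again by Theorem 3.7, (iii), (iv)]" [cite: MochizukiSemiAnbd2006, Cor 3.9 p.43].  Companion
(cell ruling α4-3 (iii), φ2-consumers; seat abc-iut-w4-d064, twin of abc-iut-w4-d080's file — the
original is untouched and its hCV-free lemma `mem_of_map_conj_eq_of_mem_verticialSubgroups` is REUSED
via the module import): the same theorems with the frozen ∀-fact `CompactInVerticial` (Thm 3.7 (iii) for EVERY graph of
anabelioids) replaced by abc-iut-w4-d075's per-graph predicate `CompactInVerticialAt H`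
(`TemperedCompactInVerticialAt.lean`; the frozen fact is `∀ H, CompactInVerticialAt H` by `Iff.rfl`), so
that the Cor 3.9 chain closes for the graphs for which Thm 3.7 (iii) is in hand (finite `𝔾`, print p. 41
"since the semi-graphs `𝔾_j` are all finite": `compactInVerticialAt_of_finite`).  Decls:
`centralizer_map_le_of_mem_verticialSubgroupsAt (hCV : CompactInVerticialAt H) (hVD hVI)
(hEIV : EdgeLikeIsInfVerticialAt H)`, `…_of_compactInVerticialAt (hCV : CompactInVerticialAt H)`, and the
named form `edgeLikeCentralizerAt_of_compactInVerticialAt : CompactInVerticialAt H → Cor39Hypotheses H →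
∀ c, EdgeLikeCentralizerAt H c`.  Proofs verbatim from the original with `hCV H ↦ hCV`, `hEIV H ↦ hEIV`.
Nothing here takes a side on [IUTchIII] Cor. 3.12; typed ≠ proved (residual: `CompactInVerticialAt H`).
-/

open CategoryTheory Topology
open scoped Pointwise

namespace Literature.AnabelianGeometry.SemiGraphs

namespace ProfiniteSemiGraph

universe u

variable {ℋ : ProfiniteSemiGraph.{u}}

/-! ### Conjugation bookkeeping -/

/-- Conjugating a subgroup by one of its own elements does nothing. [cite: MochizukiSemiAnbd2006, Thm 3.7(ii) p.40] -/
private theorem map_conj_eq_self_of_mem {Γ : Type u} [Group Γ] {K : Subgroup Γ} {g : Γ} (hg : g ∈ K) :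
    K.map (MulAut.conj g).toMonoidHom = K := by
  ext x
  simp only [Subgroup.mem_map, MulEquiv.coe_toMonoidHom, MulAut.conj_apply]
  constructor
  · rintro ⟨y, hy, rfl⟩
    exact K.mul_mem (K.mul_mem hg hy) (K.inv_mem hg)
  · intro hx
    exact ⟨g⁻¹ * x * g, K.mul_mem (K.mul_mem (K.inv_mem hg) hx) hg, by group⟩

/-- Iterated conjugation. [cite: MochizukiSemiAnbd2006, Thm 3.7(ii) p.40] -/
private theorem map_conj_map_conj {Γ : Type u} [Group Γ] (K : Subgroup Γ) (a b : Γ) :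
    (K.map (MulAut.conj a).toMonoidHom).map (MulAut.conj b).toMonoidHom =
      K.map (MulAut.conj (b * a)).toMonoidHom := by
  rw [Subgroup.map_map]
  congr 1
  ext x
  simp [MulAut.conj_apply, mul_assoc]

/-! ### (R3c): the centraliser of an open piece of an edge-like subgroup -/

/-- **(R3c) for one graph of anabelioids, φ2 twin AT `H`** — the unfolded form of
`EdgeLikeCentralizerAt H c` (`TemperedReconstructionR3Sub.lean`): under the hypotheses of Cor. 3.9 and
given Thm. 3.7 (i), (ii), Thm. 3.7 (iii) AT `H` (`CompactInVerticialAt H`) and `EdgeLikeIsInfVerticialAt H`, the centraliser in `π₁^temp(H)` of the image `ψ(U)` of an open `U ⊆ Π_e` under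
an edge homomorphism `ψ` at `e` lies in every verticial subgroup containing `ψ(U)`.
[cite: MochizukiSemiAnbd2006, Cor 3.9 p.43] -/
theorem centralizer_map_le_of_mem_verticialSubgroupsAt (hCV : CompactInVerticialAt ℋ)
    (hVD : VerticialDistinct.{u}) (hVI : VerticialInjective.{u}) (hEIV : EdgeLikeIsInfVerticialAt ℋ)
    (hℋ : Cor39Hypotheses ℋ) (c : TemperedPiChart ℋ) (e : ℋ.graph.Edge) (ψ : ℋ.Ge e →ₜ* c.G)
    (hψ : IsEdgeHom c e ψ) (U : Subgroup (ℋ.Ge e)) (hU : IsOpen (U : Set (ℋ.Ge e)))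
    (v : ℋ.graph.Vertex) (H : Subgroup c.G) (hH : H ∈ verticialSubgroups c v)
    (hUH : U.map ψ.toMonoidHom ≤ H) :
    Subgroup.centralizer ((U.map ψ.toMonoidHom : Subgroup c.G) : Set c.G) ≤ H := by
  have h37 : ℋ.Thm37Hypotheses := hℋ.thm37Hypotheses
  haveI : T2Space c.G := c.t2Space
  -- a branch `b₁` of `e`, abutting to `w₁` (every edge of a graph is closed)
  obtain ⟨b₁, b₂, hb12, rfl, hb₂e, -⟩ := ℋ.graph.two_branches e
  obtain ⟨w₁, hw₁⟩ := Option.isSome_iff_exists.mp (hℋ.isGraph.abuts_isSome b₁)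
  obtain ⟨w₂, hw₂⟩ := Option.isSome_iff_exists.mp (hℋ.isGraph.abuts_isSome b₂)
  have hclosed : ℋ.graph.IsClosedEdge (ℋ.graph.edgeOf b₁) :=
    SemiGraph.isClosedEdge_of_abuts hb12 rfl hb₂e hw₁ hw₂
  set C : Subgroup c.G := U.map ψ.toMonoidHom with hCdef
  intro c₀ hc₀
  -- the edge-like subgroup `L = ψ(Π_e)` and `C ≤ L`
  have hL : ψ.toMonoidHom.range ∈ edgeLikeSubgroups c (ℋ.graph.edgeOf b₁) := ⟨ψ, hψ, rfl⟩
  have hCL : C ≤ ψ.toMonoidHom.range := Subgroup.map_le_range _ _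
  -- `C` is infinite (hence nontrivial) and compact
  have hψinj : Function.Injective ψ := injective_of_isEdgeHom hVI h37 c b₁ w₁ hw₁ ψ hψ
  haveI hGeInf : Infinite (ℋ.Ge (ℋ.graph.edgeOf b₁)) :=
    @Infinite.of_surjective _ (ℋ.branchSubgroup b₁ w₁ hw₁)
      (infinite_branchSubgroup h37.toProp36Hypotheses hw₁)
      (ℋ.brHom b₁ w₁ hw₁).toMonoidHom.rangeRestrict (ℋ.brHom b₁ w₁ hw₁).toMonoidHom.rangeRestrict_surjective
  haveI hUinf : Infinite U := by
    haveI := Subgroup.quotient_finite_of_isOpen U hU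
    by_contra hfin
    rw [not_infinite_iff_finite] at hfin
    have hcard := Subgroup.card_mul_index U
    have h1 : Nat.card U ≠ 0 := Nat.card_pos.ne'
    have h2 : U.index ≠ 0 := Subgroup.index_ne_zero_of_finite
    have h3 : Nat.card (ℋ.Ge (ℋ.graph.edgeOf b₁)) = 0 := Nat.card_eq_zero_of_infinite
    rw [h3] at hcard
    exact (mul_ne_zero h1 h2) hcard
  haveI hCinf : Infinite C :=
    Infinite.of_injective _ (Subgroup.equivMapOfInjective U ψ.toMonoidHom hψinj).injective |>
      fun h => by rw [hCdef]; exact h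
  have hCne : C ≠ ⊥ := by
    intro hbot
    rw [hbot] at hCinf
    exact not_finite (⊥ : Subgroup c.G)
  have hCcpt : IsCompact (C : Set c.G) := by
    have hUc : IsCompact (U : Set (ℋ.Ge (ℋ.graph.edgeOf b₁))) :=
      (Subgroup.isClosed_of_isOpen U hU).isCompact
    simpa [hCdef, Subgroup.coe_map] using hUc.image ψ.continuous
  -- the two verticial hosts of `L`
  have hLne : ψ.toMonoidHom.range ≠ ⊥ := fun h0 => hCne (le_bot_iff.mp (h0 ▸ hCL))
  obtain ⟨v₁, v₂, H₁, H₂, hH₁, hH₂, hne, hLeq⟩ := hEIV h37 c _ hclosed _ hL hLne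
  have hC1 : C ≤ H₁ := hCL.trans (hLeq ▸ inf_le_left)
  have hC2 : C ≤ H₂ := hCL.trans (hLeq ▸ inf_le_right)
  -- they are the ONLY verticial subgroups containing `C` (Thm. 3.7 (iii))
  have honly : ∀ (w : ℋ.graph.Vertex) (K : Subgroup c.G), K ∈ verticialSubgroups c w → C ≤ K →
      K = H₁ ∨ K = H₂ :=
    ((hCV h37 c C hCcpt).2 hCne v₁ v₂ H₁ H₂ hH₁ hH₂ hne hC1 hC2).1
  -- conjugation by `c₀` permutes `{H₁, H₂}`
  have hfix : ∀ x ∈ C, c₀ * x * c₀⁻¹ = x := fun x hx => by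
    rw [← Subgroup.mem_centralizer_iff.mp hc₀ x hx, mul_inv_cancel_right]
  have hσ : ∀ {w : ℋ.graph.Vertex} {K : Subgroup c.G}, K ∈ verticialSubgroups c w → C ≤ K →
      K.map (MulAut.conj c₀).toMonoidHom = H₁ ∨ K.map (MulAut.conj c₀).toMonoidHom = H₂ := by
    intro w K hK hCK
    refine honly w _ (conj_mem_verticialSubgroups c hK c₀) fun x hx => ?_
    exact ⟨x, hCK hx, by simpa [MulAut.conj_apply] using hfix x hx⟩
  have hinjσ : Function.Injective (Subgroup.map (MulAut.conj c₀).toMonoidHom : Subgroup c.G → _) :=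
    Subgroup.map_injective fun a b hab => (MulAut.conj c₀).injective hab
  -- `σ² = id` on the hosts, so `c₀² ∈ H₁ ⊓ H₂`; and `σ` fixes `H₁ ⊓ H₂`
  have hσσ : ∀ {w : ℋ.graph.Vertex} {K : Subgroup c.G}, K ∈ verticialSubgroups c w → C ≤ K →
      (K = H₁ ∨ K = H₂) → K.map (MulAut.conj (c₀ * c₀)).toMonoidHom = K := by
    intro w K hK hCK hKi
    rw [← map_conj_map_conj]
    rcases hσ hH₁ hC1 with h11 | h12 <;> rcases hσ hH₂ hC2 with h21 | h22
    · exact absurd (hinjσ (h11.trans h21.symm)) hne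
    · rcases hKi with rfl | rfl
      · rw [h11, h11]
      · rw [h22, h22]
    · rcases hKi with rfl | rfl
      · rw [h12, h21]
      · rw [h21, h12]
    · exact absurd (hinjσ (h12.trans h22.symm)) hne
  have hsq1 : c₀ * c₀ ∈ H₁ :=
    mem_of_map_conj_eq_of_mem_verticialSubgroups hVD h37 c hH₁ (hσσ hH₁ hC1 (Or.inl rfl))
  have hsq2 : c₀ * c₀ ∈ H₂ :=
    mem_of_map_conj_eq_of_mem_verticialSubgroups hVD h37 c hH₂ (hσσ hH₂ hC2 (Or.inr rfl))
  set N : Subgroup c.G := H₁ ⊓ H₂ with hNdef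
  have hNfix : N.map (MulAut.conj c₀).toMonoidHom = N := by
    rw [hNdef, Subgroup.map_inf_eq _ _ _ fun a b hab => (MulAut.conj c₀).injective hab]
    rcases hσ hH₁ hC1 with h11 | h12 <;> rcases hσ hH₂ hC2 with h21 | h22
    · exact absurd (hinjσ (h11.trans h21.symm)) hne
    · rw [h11, h22]
    · rw [h12, h21, inf_comm]
    · exact absurd (hinjσ (h12.trans h22.symm)) hne
  have hc₀N : c₀ ∈ Subgroup.normalizer (N : Set c.G) := by
    rw [Subgroup.mem_normalizer_iff]
    intro x
    constructor
    · intro hx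
      rw [← hNfix]
      exact ⟨x, hx, rfl⟩
    · intro hx
      rw [← hNfix] at hx
      obtain ⟨y, hy, hyx⟩ := hx
      have : y = x := (MulAut.conj c₀).injective (by simpa [MulAut.conj_apply] using hyx)
      exact this ▸ hy
  -- the subgroup generated by `N` and `c₀` has compact closure
  have hNcpt : IsCompact (N : Set c.G) := by
    rw [hNdef, Subgroup.coe_inf]
    exact (isCompact_of_mem_verticialSubgroups c hH₁).inter_right
      (isCompact_of_mem_verticialSubgroups c hH₂).isClosed
  let S : Set c.G := (N : Set c.G) ∪ (fun x => x * c₀) '' (N : Set c.G)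
  have hScpt : IsCompact S := hNcpt.union (hNcpt.image (continuous_id.mul continuous_const))
  have hzle : Subgroup.zpowers c₀ ≤ Subgroup.normalizer (N : Set c.G) := Subgroup.zpowers_le.mpr hc₀N
  have hDS : ((N ⊔ Subgroup.zpowers c₀ : Subgroup c.G) : Set c.G) ⊆ S := by
    rw [Subgroup.coe_mul_of_right_le_normalizer_left N _ hzle]
    rintro _ ⟨n, hn, z, hz, rfl⟩
    obtain ⟨m, rfl⟩ := Subgroup.mem_zpowers_iff.mp hz
    have hsqN : c₀ * c₀ ∈ N := ⟨hsq1, hsq2⟩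
    rcases Int.even_or_odd' m with ⟨k, rfl | rfl⟩
    · left
      have : c₀ ^ (2 * k) = (c₀ * c₀) ^ k := by rw [zpow_mul]; simp [sq, zpow_ofNat]
      rw [this]
      exact N.mul_mem hn (N.zpow_mem hsqN k)
    · right
      refine ⟨n * (c₀ * c₀) ^ k, N.mul_mem hn (N.zpow_mem hsqN k), ?_⟩
      change n * (c₀ * c₀) ^ k * c₀ = n * c₀ ^ (2 * k + 1)
      rw [zpow_add_one, zpow_mul]
      simp [sq, zpow_ofNat, mul_assoc]
  let K : Subgroup c.G := (N ⊔ Subgroup.zpowers c₀).topologicalClosure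
  have hKcpt : IsCompact (K : Set c.G) := by
    have hcl : (K : Set c.G) = closure ((N ⊔ Subgroup.zpowers c₀ : Subgroup c.G) : Set c.G) :=
      Subgroup.topologicalClosure_coe
    rw [hcl]
    exact hScpt.of_isClosed_subset isClosed_closure (closure_minimal hDS hScpt.isClosed)
  -- by Thm. 3.7 (iii) it lies in a verticial subgroup, which is `H₁` or `H₂`
  obtain ⟨⟨v₃, H₃, hH₃, hKH₃⟩, -⟩ := hCV h37 c K hKcpt
  have hDK : N ⊔ Subgroup.zpowers c₀ ≤ K := Subgroup.le_topologicalClosure _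
  have hC3 : C ≤ H₃ := (le_inf hC1 hC2).trans (le_sup_left.trans (hDK.trans hKH₃))
  have hc₀3 : c₀ ∈ H₃ := hKH₃ (hDK (Subgroup.mem_sup_right (Subgroup.mem_zpowers c₀)))
  -- hence the permutation has a fixed point, so is the identity, and `c₀ ∈ H₁ ⊓ H₂`
  have hboth : c₀ ∈ H₁ ∧ c₀ ∈ H₂ := by
    rcases honly v₃ H₃ hH₃ hC3 with rfl | rfl
    · refine ⟨hc₀3, mem_of_map_conj_eq_of_mem_verticialSubgroups hVD h37 c hH₂ ?_⟩
      rcases hσ hH₂ hC2 with h21 | h22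
      · exact absurd (hinjσ (h21.trans (map_conj_eq_self_of_mem hc₀3).symm)) hne.symm
      · exact h22
    · refine ⟨mem_of_map_conj_eq_of_mem_verticialSubgroups hVD h37 c hH₁ ?_, hc₀3⟩
      rcases hσ hH₁ hC1 with h11 | h12
      · exact h11
      · exact absurd (hinjσ (h12.trans (map_conj_eq_self_of_mem hc₀3).symm)) hne
  rcases honly v H hH hUH with rfl | rfl
  · exact hboth.1
  · exact hboth.2

/-- **(R3c) AT `H`, modulo Theorem 3.7 (iii) AT `H` only** (φ2 twin of
`centralizer_map_le_of_mem_verticialSubgroups_of_compactInVerticial`): with Thm. 3.7 (i)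
`verticialInjective_holds`, (ii) `verticialDistinct_holds` and abc-iut-w4-d075's per-graph reduction
`edgeLikeIsInfVerticialAt_of_compactInVerticialAt` plugged in, the centraliser statement — i.e.
`EdgeLikeCentralizerAt H c` binder-for-binder — depends on the single per-graph fact `CompactInVerticialAt H`
(available for FINITE `H` from finite level data, `compactInVerticialAt_of_finite`).
[cite: MochizukiSemiAnbd2006, Cor 3.9 p.43] -/
theorem centralizer_map_le_of_mem_verticialSubgroups_of_compactInVerticialAt
    (hCV : CompactInVerticialAt ℋ) (hℋ : Cor39Hypotheses ℋ) (c : TemperedPiChart ℋ)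
    (e : ℋ.graph.Edge) (ψ : ℋ.Ge e →ₜ* c.G) (hψ : IsEdgeHom c e ψ) (U : Subgroup (ℋ.Ge e))
    (hU : IsOpen (U : Set (ℋ.Ge e))) (v : ℋ.graph.Vertex) (H : Subgroup c.G)
    (hH : H ∈ verticialSubgroups c v) (hUH : U.map ψ.toMonoidHom ≤ H) :
    Subgroup.centralizer ((U.map ψ.toMonoidHom : Subgroup c.G) : Set c.G) ≤ H :=
  centralizer_map_le_of_mem_verticialSubgroupsAt hCV verticialDistinct_holds verticialInjective_holds
    (edgeLikeIsInfVerticialAt_of_compactInVerticialAt hCV) hℋ c e ψ hψ U hU v H hH hUH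

/-- **(R3c) AT `H` in the named form `EdgeLikeCentralizerAt H c`** (the hypothesis consumed by (R3a)
`twistAbsorption_holds`), from `CompactInVerticialAt H` alone. [cite: MochizukiSemiAnbd2006, Cor 3.9 p.43] -/
theorem edgeLikeCentralizerAt_of_compactInVerticialAt (hCV : CompactInVerticialAt ℋ)
    (hℋ : Cor39Hypotheses ℋ) (c : TemperedPiChart ℋ) : EdgeLikeCentralizerAt ℋ c :=
  fun e ψ hψ U hU v H hH hUH =>
    centralizer_map_le_of_mem_verticialSubgroups_of_compactInVerticialAt hCV hℋ c e ψ hψ U hU v H hH hUH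

end ProfiniteSemiGraph

end Literature.AnabelianGeometry.SemiGraphs
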